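import Summits.Schanuel.Schanuel.Theses.BenfordTowers

/-!
# Schanuel / BenfordTowers — split of `BenfordFamily` (stmt-Schanuel-11400): `HomPrimeLogSector → BenfordOfHom → BenfordFamily`

Landable Theorems-shape copy (target `Summits/Schanuel/Schanuel/Theorems/BenfordTowersBenfordFamilySplit.lean`,
`--supports stmt-Schanuel-11400`) of the crux workfile `Cruxes/BenfordFamily/Lines/DictionarySplit.lean`, attached
as item evidence by the crux strategist (planner; Theorems/ is prover-only, CONVENTIONS §6) for a prover to land
verbatim.  It proves the ASSEMBLY of the dictionary split of the route's crux `BenfordFamily` into the two existing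
items `HomPrimeLogSector` (stmt-Schanuel-11402, open) and `BenfordOfHom` (stmt-Schanuel-11406, provable):
modus ponens (`trivial_seam`, human ruling 2026-08-16).
-/

set_option linter.dupNamespace false

namespace Summit.Schanuel.Schanuel.Theorems.BenfordTowers

open Summit.Schanuel.Schanuel.Theses.BenfordTowers

/-- Split glue for `BenfordTowers.BenfordFamily`: `HomPrimeLogSector → BenfordOfHom → BenfordFamily`
(modus ponens: `BenfordOfHom` is `HomPrimeLogSector → BenfordFamily`). [folklore] -/
theorem BenfordFamily_of_subs : HomPrimeLogSector → BenfordOfHom → BenfordFamily :=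
  fun hHom hDict => hDict hHom

/-- Closes the glue item stmt-Schanuel-17882 `BenfordTowers.BenfordFamilyOfSubs` BY NAME (same term). [folklore] -/
theorem benfordFamilyOfSubs : BenfordFamilyOfSubs :=
  fun hHom hDict => hDict hHom

end Summit.Schanuel.Schanuel.Theorems.BenfordTowers
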